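import Summits.BirchSwinnertonDyer.Rank1Residual.GaloisImage.LocalThreeTorsionAdicCompletion
import Summits.BirchSwinnertonDyer.Rank1Residual.X11b.LocalTorsionAwayFromP
import Summits.BirchSwinnertonDyer.BirchSwinnertonDyer.Theorems.Rank2ObservatoryTamagawaLocal
import Summits.BirchSwinnertonDyer.BirchSwinnertonDyer.Theorems.Rank1ResidualIntModelReduction
import Summits.BirchSwinnertonDyer.BirchSwinnertonDyer.Theorems.Rank1ResidualX11RankOneMinimality
import Summits.BirchSwinnertonDyer.Rank1Residual.Additive.IntModelTamagawaCertificate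
import Summits.BirchSwinnertonDyer.Rank1Residual.X11b.ChaPairsMinimality
import Summits.BirchSwinnertonDyer.Rank1Residual.Additive.X4ThreeResCertKernel
import Summits.BirchSwinnertonDyer.Rank1Residual.Additive.LocalLogImageRat
import Literature.NumberTheory.EllipticCurves.TamagawaRingEquivProofs
import HarnessLib

/-!
# The local torsion count AWAY from `p`, visibility currency: `#E(ℚ_v)[p] = 1` at a place `v ∤ p`
# from the numeric test `p ∤ c_v · #Ẽ_ns(𝔽_ℓ)` (team n1011, row T-VIS3 (iv)-PREP FILE 2; seat p18 GEN 8)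

HONEST FRAMING (cell `b2b-bsdres`, run/shared/lean/b2b/bsd-rank1-residual/, verbatim in every
file): the goal of the cell is to DELETE the COMBINATION-SHAPED residual classes of the
Birch–Swinnerton-Dyer formula for ALL analytic-rank `≤ 1` elliptic curves over `ℚ` — "full BSD
formula for every rank `≤ 1` curve in class `C`" assembled STRICTLY from published theorems — so
that the rank-`≤ 1` remainder becomes exactly the CONSTRUCTION-SHAPED classes, which are TYPED
(missing-input `Prop`s), NOT attempted. This is not "finishing BSD". Team n1011 (N10/N11 = X4 ∧
`p = 3`, research route; ROW T-VIS3 = r1 ROUTE-1 §40.3 (d) / R1-74, lead R5-77 (e) / R5-78 ADD 2).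
THIS FILE IS A TOOL: theorems only (no definition, no named fact, no `sorry`); it closes nothing,
books nothing, moves no mark / label / count.

## What and why

The tree's visibility certificates (x11a `exists_sha_ne_zero_of_congr_of_rank` / `_of_places`,
n1011-p04's `GaloisImage/VisibleLowerBoundThree.lean`) carry the local binder

  `hloc : ∀ v ∈ S, Nat.card (nsmulAddMonoidHom p : (E'.baseChange (v.adicCompletion ℚ)).toAffine.Point →+ _).ker = 1`

at every place of `S = bad(E) ∪ bad(E′) ∪ {v ∣ p}`.  FILE 1 (`LocalThreeTorsionAdicCompletion`)
discharges it at `v ∣ 3` from n1011-p17's decider.  At the places `v ∤ p` the tree ALREADY holds a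
sufficient NUMERIC test in the `ℚ_[ℓ]` currency — sub-cell multr1-p1's
`X11b.LocalTorsion.padicTorsion_eq_zero_of_not_dvd` (`X11b/LocalTorsionAwayFromP.lean`): for a
globally minimal `E/ℚ` and primes `ℓ ≠ p`, `p ∤ c_ℓ(E) · N_ℓ` (`N_ℓ = reductionPointCount E ℓ =
#Ẽ_ns(𝔽_ℓ)`, `c_ℓ` the Tamagawa number) forces `E(ℚ_ℓ)[p] = 0` (local filtration
`[E(ℚ_ℓ) : E₁(ℚ_ℓ)] = c_ℓ · N_ℓ`, `E₁(ℚ_ℓ)[p] = 0`; Silverman VII.2.1, IV.3.2(b)).  This file moves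
that test into the visibility currency through FILE 1's bridge and makes its two numbers kernel
numerals:

* `natCard_torsion_padic_eq_one_of_forall_eq_zero` — `#{Q ∈ E(ℚ_[ℓ]) : n • Q = 0} = 1` when every
  such `Q` is `O` (pure algebra);
* **`natCard_ker_nsmul_adicCompletion_eq_one_of_not_dvd`** — `ℓ ≠ p`, `p ∤ c_v · N_ℓ` (the
  Tamagawa number READ AT THE PLACE `v` of `ℓ`) ⟹ `#ker([p] : E(ℚ_v)) = 1`, literally `hloc` at
  `v`; numeral form `…_of_eq_of_eq` (`c_v = c`, `N_ℓ = N`, `p ∤ c·N` by `decide`);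
* `reductionPointCount_eq_of_intModel_of_nodal_euler` / `…_of_nodal_root` — at a MULTIPLICATIVE `ℓ`
  (`ℓ ∣ Δ`, `ℓ ∤ c₄` on the integral model) the count `N_ℓ` is `ℓ + 1` (non-split: Euler witness
  `d^{(ℓ−1)/2} = −1` on the discriminant `d` of the node-tangent quadratic) or `ℓ − 1` (split: a root
  `t` of the node-tangent quadratic mod `ℓ`) — the tree's `reductionPointCount_of_mult` +
  `hasSplitMultiplicativeReductionAtPrime_iff_splits` + the observatory's `not_splits_nodalPoly_of_euler`
  / `splits_nodalPoly_of_dvd`, so that NO point enumeration over `𝔽_ℓ` is needed at a bad `ℓ`;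
* `natCard_ker_nsmul_adicCompletion_eq_one_of_intModel_of_nodal_{euler,root}` — `hloc` at a
  non-split / split multiplicative `ℓ ≠ p` from the witnesses above, ONE `TamLocal` certificate and
  `p ∤ c·(ℓ ± 1)`;
* `natCard_ker_nsmul_adicCompletion_eq_one_of_intModel_of_additive` — at an ADDITIVE `ℓ ≠ p`
  (`ℓ ∣ Δ`, `ℓ ∣ c₄`): `N_ℓ = ℓ` (n1011 `LocalLog.reductionPointCount_of_addv`), so `hloc` follows
  from a Tate certificate `c(W/ℚ_[ℓ]) = c` and `p ∤ c · ℓ`; `…_of_padic_eq_of_eq` accepts the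
  Tamagawa number in the `ℚ_[ℓ]` currency of n1011-p03's `IntModelTam` certificate forms;
* `localTamagawaNumber_eq_of_intModel_of_tamLocal` — `c_v = c` at the place `v` of `ℓ` from ONE
  kernel certificate `TamLocal` of the rank-2 observatory (`TamLocal.sound_exact`) for a globally
  minimal `W/ℚ` with integral model `W₀`;
* `natCard_ker_nsmul_adicCompletion_eq_one_2718f1_151` — ONE instance: the V40 partner
  `2718f1 = [1, -1, 0, -99, 409]` (rank 2; r1 §40.3: `2718d1 ~ 2718f1`, Cremona–Mazur 2000 Table 1
  pair 2718D–F) at the place of `151` for `p = 3`: non-split `I₁` (Euler witness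
  `75⁷⁵ ≡ −1 (mod 151)`), `c₁₅₁ = 1` (kind-3 `TamLocal` certificate), `N₁₅₁ = 152`, `3 ∤ 152`; the
  model is globally minimal by the bounded Kraus criterion (`decide`).  At the place of `2` the test
  FAILS for this partner (`#Ẽ_ns(𝔽₂) = 3`: both `2718d1` and `2718f1` are non-split at `2`), so
  that row's certificate must use the multiplicative free kind of
  `exists_sha_ne_zero_of_congr_of_places` at `2` — recorded, not claimed here.

NOT claimed: the place `v ∣ p` (FILE 1 / x11c `MultiplicativeLocalTorsion`), any congruence, rank
certificate or record; rows where `p ∣ c_ℓ` (the test is then insufficient).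

References: [SilvermanAEC2009] VII.2 Prop. 2.1, VII.3 Prop. 3.1, IV.3 Prop. 3.2(b), VII.5 Prop.
5.1(b), Ex. 3.5; [SilvermanATAEC1994] IV.9.4 (Tate's algorithm); [CremonaMazur2000] §3, Table 1;
[Cremona2006] (labels, models).
-/

set_option autoImplicit false

noncomputable section

open scoped Classical NumberField
open IsDedekindDomain NumberField WeierstrassCurve Rat.HeightOneSpectrum Polynomial
  Literature.NumberTheory.EllipticCurves Literature.NumberTheory.EllipticCurves.Rank1Residual
  Summit.BirchSwinnertonDyer.BirchSwinnertonDyer.Rank1Residual.IntModel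
  Summit.BirchSwinnertonDyer.BirchSwinnertonDyer.Rank1Residual.X11RankOne
  Summit.BirchSwinnertonDyer.BirchSwinnertonDyer.Rank2Observatory
  Summit.BirchSwinnertonDyer.BirchSwinnertonDyer.Rank2Observatory.Tam
  Summit.BirchSwinnertonDyer.Rank1Residual.X11b

namespace Summit.BirchSwinnertonDyer.Rank1Residual.GaloisImage.LocalTorsionAway

/-! ### §1. Counting a trivial torsion subgroup -/

/-- If every `Q` with `n • Q = 0` is `O`, the subtype `{Q // n • Q = 0}` has exactly one element.
[folklore] -/
theorem natCard_torsion_padic_eq_one_of_forall_eq_zero {A : Type*} [AddCommGroup A] (n : ℕ)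
    (h : ∀ Q : A, n • Q = 0 → Q = 0) : Nat.card {Q : A // n • Q = 0} = 1 := by
  haveI : Unique {Q : A // n • Q = 0} :=
    { default := ⟨0, nsmul_zero n⟩
      uniq := fun Q => Subtype.ext (h Q.1 Q.2) }
  exact Nat.card_unique

/-! ### §2. `hloc` at a place `v ∤ p` from the numeric test `p ∤ c_v · N_ℓ` -/

/-- The place `v` of `𝓞 ℚ` with `primesEquiv v = ℓ` is x11b's `ratPlace ℓ`. [folklore] -/
theorem eq_ratPlace_of_primesEquiv_eq {ℓ : ℕ} [Fact ℓ.Prime] {v : HeightOneSpectrum (𝓞 ℚ)}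
    (hv : (primesEquiv v : ℕ) = ℓ) : v = ratPlace ℓ := by
  apply (primesEquiv (R := 𝓞 ℚ)).injective
  rw [ratPlace, Equiv.apply_symm_apply]
  exact Subtype.ext hv

/-- **`#E(ℚ_v)[p] = 1` at a place `v ∤ p` from `p ∤ c_v · N_ℓ`** — the visibility binder `hloc` at
`v`: for a globally minimal elliptic `W/ℚ`, primes `ℓ ≠ p`, `v` the place of `ℓ`, and
`p ∤ c_v(W) · reductionPointCount W ℓ` (`c_v` the local Tamagawa number at `v`,
`reductionPointCount W ℓ = #Ẽ_ns(𝔽_ℓ)`), the kernel of `[p]` on `E(ℚ_v)` is trivial.  x11b's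
`LocalTorsion.padicTorsion_eq_zero_of_not_dvd` (local filtration, Silverman VII.2.1 / IV.3.2(b))
moved along FILE 1's bridge `natCard_ker_nsmul_adicCompletion_eq_natCard_torsion_padic`.
[cite: SilvermanAEC2009, VII.2 Prop. 2.1 and IV.3 Prop. 3.2(b)] -/
theorem natCard_ker_nsmul_adicCompletion_eq_one_of_not_dvd (W : WeierstrassCurve ℚ) [W.IsElliptic]
    [W.IsGloballyMinimal] (ℓ p : ℕ) [Fact ℓ.Prime] [Fact p.Prime] (hℓp : ℓ ≠ p)
    {v : HeightOneSpectrum (𝓞 ℚ)} (hv : (primesEquiv v : ℕ) = ℓ)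
    (h : ¬ p ∣ (W.baseChange (v.adicCompletion ℚ)).localTamagawaNumber (v.adicCompletionIntegers ℚ) *
      reductionPointCount W ℓ) :
    Nat.card (nsmulAddMonoidHom p : (W.baseChange (v.adicCompletion ℚ)).toAffine.Point →+
      (W.baseChange (v.adicCompletion ℚ)).toAffine.Point).ker = 1 := by
  rw [LocalTorsion3.natCard_ker_nsmul_adicCompletion_eq_natCard_torsion_padic W v hv p]
  obtain rfl : v = ratPlace ℓ := eq_ratPlace_of_primesEquiv_eq hv
  exact natCard_torsion_padic_eq_one_of_forall_eq_zero p
    (LocalTorsion.padicTorsion_eq_zero_of_not_dvd W ℓ p hℓp h)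

/-- **Numeral form**: with `c_v = c` and `reductionPointCount W ℓ = N` given (kernel certificates of
the consumer) and `p ∤ c · N` (`decide`), `#ker([p] : E(ℚ_v)) = 1`.
[cite: SilvermanAEC2009, VII.2 Prop. 2.1 and IV.3 Prop. 3.2(b)] -/
theorem natCard_ker_nsmul_adicCompletion_eq_one_of_eq_of_eq (W : WeierstrassCurve ℚ) [W.IsElliptic]
    [W.IsGloballyMinimal] (ℓ p : ℕ) [Fact ℓ.Prime] [Fact p.Prime] (hℓp : ℓ ≠ p)
    {v : HeightOneSpectrum (𝓞 ℚ)} (hv : (primesEquiv v : ℕ) = ℓ) {c N : ℕ}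
    (hc : (W.baseChange (v.adicCompletion ℚ)).localTamagawaNumber (v.adicCompletionIntegers ℚ) = c)
    (hN : reductionPointCount W ℓ = N) (h : ¬ p ∣ c * N) :
    Nat.card (nsmulAddMonoidHom p : (W.baseChange (v.adicCompletion ℚ)).toAffine.Point →+
      (W.baseChange (v.adicCompletion ℚ)).toAffine.Point).ker = 1 :=
  natCard_ker_nsmul_adicCompletion_eq_one_of_not_dvd W ℓ p hℓp hv (by rwa [hc, hN])

/-- **Numeral form, `ℚ_[ℓ]` currency for the Tamagawa number** (the output currency of n1011-p03's
`IntModelTam.localTamagawaNumber_padic_eq_of_intModel_of_{tamLocal,tamX,tamZ}`): with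
`c(W / ℚ_[ℓ]) = c`, `reductionPointCount W ℓ = N` and `p ∤ c · N`, `#ker([p] : E(ℚ_v)) = 1` at the
place `v` of `ℓ` (the tree's transport `localTamagawaNumber_padic_eq_holds`).
[cite: SilvermanAEC2009, VII.2 Prop. 2.1 and IV.3 Prop. 3.2(b)] -/
theorem natCard_ker_nsmul_adicCompletion_eq_one_of_padic_eq_of_eq (W : WeierstrassCurve ℚ)
    [W.IsElliptic] [W.IsGloballyMinimal] (ℓ p : ℕ) [Fact ℓ.Prime] [Fact p.Prime] (hℓp : ℓ ≠ p)
    {v : HeightOneSpectrum (𝓞 ℚ)} (hv : (primesEquiv v : ℕ) = ℓ) {c N : ℕ}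
    (hc : (W.baseChange ℚ_[ℓ]).localTamagawaNumber ℤ_[ℓ] = c)
    (hN : reductionPointCount W ℓ = N) (h : ¬ p ∣ c * N) :
    Nat.card (nsmulAddMonoidHom p : (W.baseChange (v.adicCompletion ℚ)).toAffine.Point →+
      (W.baseChange (v.adicCompletion ℚ)).toAffine.Point).ker = 1 :=
  natCard_ker_nsmul_adicCompletion_eq_one_of_eq_of_eq W ℓ p hℓp hv
    (by rw [← WeierstrassCurve.localTamagawaNumber_padic_eq_holds W v ℓ hv, hc]) hN h

/-! ### §3. The two numbers as kernel numerals for a curve given by its integral model -/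

section IntModel

variable {W : WeierstrassCurve ℚ} [W.IsElliptic] [W.IsGloballyMinimal] {W₀ : WeierstrassCurve ℤ}

omit [W.IsElliptic] in
/-- **`c_v = c` from ONE kernel Tamagawa certificate** of the rank-2 observatory at the place `v` of
`ℓ = E.p`, for a globally minimal `W/ℚ` with integral model `W₀` (`TamLocal.sound_exact`; minimality
at `v` from global minimality). [cite: SilvermanATAEC1994, IV.9.4] -/
theorem localTamagawaNumber_eq_of_intModel_of_tamLocal (hI : integralModelInt W = W₀)
    {v : HeightOneSpectrum (𝓞 ℚ)} {E : TamLocal} (hv : (primesEquiv v : ℕ) = E.p)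
    (hcheck : E.check W₀ = true) {c : ℕ} (hvals : E.vals = [c]) :
    (W.baseChange (v.adicCompletion ℚ)).localTamagawaNumber (v.adicCompletionIntegers ℚ) = c := by
  have hGM : (W₀.baseChange ℚ).IsGloballyMinimal :=
    Additive.IntModelTam.eq_baseChange_of_integralModelInt hI ▸ ‹W.IsGloballyMinimal›
  have key := TamLocal.sound_exact (W₀ := W₀) (E := E) v hv (hGM.isMinimal v) hcheck hvals
  rwa [tam, ← Additive.IntModelTam.eq_baseChange_of_integralModelInt hI] at key

/-- **`N_ℓ = ℓ + 1` at a NON-SPLIT multiplicative `ℓ`, by an Euler witness**: `ℓ ∣ Δ(W₀)`,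
`ℓ ∤ c₄(W₀)`, `ℓ` odd, and `d^{(ℓ−1)/2} = −1` in `ℤ/ℓ` for the discriminant `d` of the node-tangent
quadratic ⟹ `reductionPointCount W ℓ = ℓ + 1` (`#Ẽ_ns(𝔽_ℓ)` of the norm-one torus, with `Õ`).
[cite: SilvermanAEC2009, VII.5 Prop. 5.1(b) and Exercise 3.5] -/
theorem reductionPointCount_eq_of_intModel_of_nodal_euler (hI : integralModelInt W = W₀) (ℓ : ℕ)
    [Fact ℓ.Prime] (hΔ : (ℓ : ℤ) ∣ W₀.Δ) (hc₄ : ¬ (ℓ : ℤ) ∣ W₀.c₄) (h2 : ℓ ≠ 2)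
    (heuler : ((RootNumber.nodalDisc W₀ : ℤ) : ZMod ℓ) ^ (ℓ / 2) = -1) :
    reductionPointCount W ℓ = ℓ + 1 := by
  have hmult : Mult W ℓ := hasMultiplicativeReductionAtPrime_of_intModel hI ℓ hΔ hc₄
  have hns : ¬ W.HasSplitMultiplicativeReductionAtPrime ℓ := fun hs =>
    not_splits_nodalPoly_of_euler hc₄ h2 heuler
      ((hasSplitMultiplicativeReductionAtPrime_iff_splits hI ℓ hΔ hc₄).mp hs)
  exact (LocalTorsion.reductionPointCount_of_mult W ℓ hmult).2 hns

/-- **`N_ℓ + 1 = ℓ` at a SPLIT multiplicative `ℓ`, by a root witness**: `ℓ ∣ Δ(W₀)`, `ℓ ∤ c₄(W₀)`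
and an integer `t` with `ℓ ∣ nodalValue W₀ t` (a root of the node-tangent quadratic mod `ℓ`)
⟹ `reductionPointCount W ℓ + 1 = ℓ` (`#Ẽ_ns(𝔽_ℓ) = ℓ − 1`, the split torus, with `Õ`).
[cite: SilvermanAEC2009, VII.5 Prop. 5.1(b) and Exercise 3.5] -/
theorem reductionPointCount_eq_of_intModel_of_nodal_root (hI : integralModelInt W = W₀) (ℓ : ℕ)
    [Fact ℓ.Prime] (hΔ : (ℓ : ℤ) ∣ W₀.Δ) (hc₄ : ¬ (ℓ : ℤ) ∣ W₀.c₄) {t : ℤ}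
    (ht : (ℓ : ℤ) ∣ RootNumber.nodalValue W₀ t) :
    reductionPointCount W ℓ + 1 = ℓ := by
  have hmult : Mult W ℓ := hasMultiplicativeReductionAtPrime_of_intModel hI ℓ hΔ hc₄
  have hs : W.HasSplitMultiplicativeReductionAtPrime ℓ :=
    (hasSplitMultiplicativeReductionAtPrime_iff_splits hI ℓ hΔ hc₄).mpr (splits_nodalPoly_of_dvd hc₄ ht)
  exact (LocalTorsion.reductionPointCount_of_mult W ℓ hmult).1 hs

/-- **`hloc` at a NON-SPLIT multiplicative place `v ∤ p` of the integral model, all numbers in the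
kernel**: `W/ℚ` globally minimal with integral model `W₀`, `ℓ ≠ p` primes, `ℓ` odd, `ℓ ∣ Δ(W₀)`,
`ℓ ∤ c₄(W₀)`, an Euler witness of non-splitness, ONE `TamLocal` certificate with value `c`, and
`p ∤ c · (ℓ + 1)` ⟹ `#ker([p] : E(ℚ_v)) = 1`.
[cite: SilvermanAEC2009, VII.2 Prop. 2.1, IV.3 Prop. 3.2(b), VII.5 Prop. 5.1(b)] -/
theorem natCard_ker_nsmul_adicCompletion_eq_one_of_intModel_of_nodal_euler
    (hI : integralModelInt W = W₀) (ℓ p : ℕ) [Fact ℓ.Prime] [Fact p.Prime] (hℓp : ℓ ≠ p)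
    {v : HeightOneSpectrum (𝓞 ℚ)} (hv : (primesEquiv v : ℕ) = ℓ)
    (hΔ : (ℓ : ℤ) ∣ W₀.Δ) (hc₄ : ¬ (ℓ : ℤ) ∣ W₀.c₄) (h2 : ℓ ≠ 2)
    (heuler : ((RootNumber.nodalDisc W₀ : ℤ) : ZMod ℓ) ^ (ℓ / 2) = -1)
    {E : TamLocal} (hEp : E.p = ℓ) (hcheck : E.check W₀ = true) {c : ℕ} (hvals : E.vals = [c])
    (h : ¬ p ∣ c * (ℓ + 1)) :
    Nat.card (nsmulAddMonoidHom p : (W.baseChange (v.adicCompletion ℚ)).toAffine.Point →+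
      (W.baseChange (v.adicCompletion ℚ)).toAffine.Point).ker = 1 :=
  natCard_ker_nsmul_adicCompletion_eq_one_of_eq_of_eq W ℓ p hℓp hv
    (localTamagawaNumber_eq_of_intModel_of_tamLocal hI (hv.trans hEp.symm) hcheck hvals)
    (reductionPointCount_eq_of_intModel_of_nodal_euler hI ℓ hΔ hc₄ h2 heuler) h

/-- **`hloc` at a SPLIT multiplicative place `v ∤ p` of the integral model, all numbers in the
kernel**: `ℓ ∣ Δ(W₀)`, `ℓ ∤ c₄(W₀)`, a root `t` of the node-tangent quadratic mod `ℓ` (split, so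
`N_ℓ = ℓ − 1`), ONE `TamLocal` certificate with value `c` (`= ord_ℓ Δ` for a kind-1 certificate), and
`p ∤ c · (ℓ − 1)` ⟹ `#ker([p] : E(ℚ_v)) = 1`.
[cite: SilvermanAEC2009, VII.2 Prop. 2.1, IV.3 Prop. 3.2(b), VII.5 Prop. 5.1(b)] -/
theorem natCard_ker_nsmul_adicCompletion_eq_one_of_intModel_of_nodal_root
    (hI : integralModelInt W = W₀) (ℓ p : ℕ) [Fact ℓ.Prime] [Fact p.Prime] (hℓp : ℓ ≠ p)
    {v : HeightOneSpectrum (𝓞 ℚ)} (hv : (primesEquiv v : ℕ) = ℓ)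
    (hΔ : (ℓ : ℤ) ∣ W₀.Δ) (hc₄ : ¬ (ℓ : ℤ) ∣ W₀.c₄) {t : ℤ}
    (ht : (ℓ : ℤ) ∣ RootNumber.nodalValue W₀ t)
    {E : TamLocal} (hEp : E.p = ℓ) (hcheck : E.check W₀ = true) {c : ℕ} (hvals : E.vals = [c])
    (h : ¬ p ∣ c * (ℓ - 1)) :
    Nat.card (nsmulAddMonoidHom p : (W.baseChange (v.adicCompletion ℚ)).toAffine.Point →+
      (W.baseChange (v.adicCompletion ℚ)).toAffine.Point).ker = 1 :=
  natCard_ker_nsmul_adicCompletion_eq_one_of_eq_of_eq W ℓ p hℓp hv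
    (localTamagawaNumber_eq_of_intModel_of_tamLocal hI (hv.trans hEp.symm) hcheck hvals)
    (N := ℓ - 1) (by have := reductionPointCount_eq_of_intModel_of_nodal_root hI ℓ hΔ hc₄ ht; omega) h

/-- **`hloc` at an ADDITIVE place `v ∤ p` of the integral model**: `ℓ ∣ Δ(W₀)`, `ℓ ∣ c₄(W₀)`
(additive reduction, Silverman VII.5.1(c); `N_ℓ = #𝔾_a(𝔽_ℓ) = ℓ`, n1011's
`LocalLog.reductionPointCount_of_addv`), the local Tamagawa number `c(W / ℚ_[ℓ]) = c` (a Tate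
certificate of the consumer, `IntModelTam…`) and `p ∤ c · ℓ` ⟹ `#ker([p] : E(ℚ_v)) = 1`.
[cite: SilvermanAEC2009, VII.2 Prop. 2.1, IV.3 Prop. 3.2(b), VII.5 Prop. 5.1(c), Exercise 3.5] -/
theorem natCard_ker_nsmul_adicCompletion_eq_one_of_intModel_of_additive
    (hI : integralModelInt W = W₀) (ℓ p : ℕ) [Fact ℓ.Prime] [Fact p.Prime] (hℓp : ℓ ≠ p)
    {v : HeightOneSpectrum (𝓞 ℚ)} (hv : (primesEquiv v : ℕ) = ℓ)
    (hΔ : (ℓ : ℤ) ∣ W₀.Δ) (hc₄ : (ℓ : ℤ) ∣ W₀.c₄) {c : ℕ}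
    (hc : (W.baseChange ℚ_[ℓ]).localTamagawaNumber ℤ_[ℓ] = c) (h : ¬ p ∣ c * ℓ) :
    Nat.card (nsmulAddMonoidHom p : (W.baseChange (v.adicCompletion ℚ)).toAffine.Point →+
      (W.baseChange (v.adicCompletion ℚ)).toAffine.Point).ker = 1 :=
  natCard_ker_nsmul_adicCompletion_eq_one_of_padic_eq_of_eq W ℓ p hℓp hv hc
    (Additive.LocalLog.reductionPointCount_of_addv W ℓ (Additive.addv_of_intModel hI ℓ hΔ hc₄)) h

end IntModel

/-! ### §4. Instance: the V40 partner `2718f1` at the place of `151`, `p = 3` -/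

/-- The kind-3 (`non-split by Euler`) local Tamagawa certificate of `2718f1 = [1, -1, 0, -99, 409]` at
`151` — `⟨p, sq, kind, w, r, s, t, n, exit, k, c⟩ = ⟨151, 12, 3, 0, 0, 0, 0, 1, 0, 0, 1⟩` (`I₁`,
`c₁₅₁ = 1`) — passes the kernel check. [cite: SilvermanATAEC1994, IV.9.4] -/
theorem tamLocal_check_2718f1_151 :
    TamLocal.check ⟨151, 12, 3, 0, 0, 0, 0, 1, 0, 0, 1⟩ ⟨1, -1, 0, -99, 409⟩ = true := by
  decide +kernel

/-- The Euler witness of NON-split reduction of `2718f1` at `151`: the discriminant `d` of the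
node-tangent quadratic has `d ≡ 75` and `75⁷⁵ = −1` in `ℤ/151`. [cite: SilvermanAEC2009, VII.5 Prop. 5.1(b)] -/
theorem nodal_euler_2718f1_151 :
    ((RootNumber.nodalDisc ⟨1, -1, 0, -99, 409⟩ : ℤ) : ZMod 151) ^ (151 / 2) = -1 := by
  decide +kernel

/-- **`2718f1` at the place of `151`, `p = 3`: `E′(ℚ_v)[3] = 0` IN THE KERNEL** (the T-VIS3 binder
`hloc` at `v = 151` for the pair `2718d1 ~ 2718f1`, in the record binder shape
`hW' : W' = ⟨1, -1, 0, -99, 409⟩`): the model is globally minimal (bounded Kraus criterion,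
`decide`: no `q` with `q¹² ∣ Δ = −2²·3⁷·151`), `151 ∥ Δ`, `151 ∤ c₄ = 3²·23²`, non-split by the
Euler witness `d ≡ 75`, `75⁷⁵ ≡ −1 (mod 151)` (`N₁₅₁ = 152`), `c₁₅₁ = 1` by
`tamLocal_check_2718f1_151`, and `3 ∤ 1 · 152`. Per partner; nothing booked.
[cite: CremonaMazur2000, §3 and Table 1] [cite: Cremona2006, Table 1 (label 2718f1)] -/
theorem natCard_ker_nsmul_adicCompletion_eq_one_2718f1_151 (W' : WeierstrassCurve ℚ)
    (hW' : W' = ⟨1, -1, 0, -99, 409⟩) {v : HeightOneSpectrum (𝓞 ℚ)}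
    (hv : (primesEquiv v : ℕ) = 151) :
    Nat.card (nsmulAddMonoidHom 3 : (W'.baseChange (v.adicCompletion ℚ)).toAffine.Point →+
      (W'.baseChange (v.adicCompletion ℚ)).toAffine.Point).ker = 1 := by
  subst hW'
  haveI hE' : (⟨1, -1, 0, -99, 409⟩ : WeierstrassCurve ℚ).IsElliptic :=
    isElliptic_of_discOf_ne_zero 1 (-1) 0 (-99) 409 (by decide +kernel)
  haveI hM' : (⟨1, -1, 0, -99, 409⟩ : WeierstrassCurve ℚ).IsGloballyMinimal :=
    isGloballyMinimal_of_krausCriterion_bounded 1 (-1) 0 (-99) 409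
      (by decide +kernel) (by decide +kernel) (by decide +kernel)
  haveI : Fact (Nat.Prime 151) := ⟨by norm_num⟩
  haveI : Fact (Nat.Prime 3) := ⟨Nat.prime_three⟩
  have hI' : integralModelInt (⟨1, -1, 0, -99, 409⟩ : WeierstrassCurve ℚ) =
      (⟨1, -1, 0, -99, 409⟩ : WeierstrassCurve ℤ) :=
    integralModelInt_eq_of_map_eq _ (map_mk_int 1 (-1) 0 (-99) 409)
  exact natCard_ker_nsmul_adicCompletion_eq_one_of_intModel_of_nodal_euler hI' 151 3 (by norm_num) hv
    (by decide +kernel) (by decide +kernel) (by norm_num) nodal_euler_2718f1_151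
    (E := ⟨151, 12, 3, 0, 0, 0, 0, 1, 0, 0, 1⟩) rfl tamLocal_check_2718f1_151 (c := 1) (by decide)
    (by norm_num)

/-! ### §5 (append, p18 GEN 8). Value-SET forms: `hloc` from ONE `TamLocal` certificate whose
certified set is not a singleton (Kodaira `IV`, `IV*`, `I₀*`, `Iₙ*`: `c_v ∈ {1,3}`, `{1,2,4}`, `{2,4}`) -/

section IntModelVals

variable {W : WeierstrassCurve ℚ} [W.IsElliptic] [W.IsGloballyMinimal] {W₀ : WeierstrassCurve ℤ}

omit [W.IsElliptic] in
/-- **`c_v ∈ E.vals` from ONE kernel Tamagawa certificate** (`TamLocal.sound`, the membership form: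
no exactness needed) at the place `v` of `ℓ = E.p`, for a globally minimal `W/ℚ` with integral model
`W₀`. [cite: SilvermanATAEC1994, IV.9.4] -/
theorem localTamagawaNumber_mem_of_intModel_of_tamLocal (hI : integralModelInt W = W₀)
    {v : HeightOneSpectrum (𝓞 ℚ)} {E : TamLocal} (hv : (primesEquiv v : ℕ) = E.p)
    (hcheck : E.check W₀ = true) :
    (W.baseChange (v.adicCompletion ℚ)).localTamagawaNumber (v.adicCompletionIntegers ℚ) ∈ E.vals := by
  have hGM : (W₀.baseChange ℚ).IsGloballyMinimal :=
    Additive.IntModelTam.eq_baseChange_of_integralModelInt hI ▸ ‹W.IsGloballyMinimal›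
  have key := TamLocal.sound (W₀ := W₀) (E := E) v hv (hGM.isMinimal v) hcheck
  rwa [tam, ← Additive.IntModelTam.eq_baseChange_of_integralModelInt hI] at key

/-- **`hloc` from a value-SET Tamagawa certificate**: `ℓ ≠ p`, `reductionPointCount W ℓ = N`, ONE
`TamLocal` certificate at `ℓ` (any kind — multiplicative, Step-2 or deep Tate), and `p ∤ c · N` for EVERY
`c` in its certified value set (`decide`) ⟹ `#ker([p] : E(ℚ_v)) = 1` at the place `v` of `ℓ`.  This is
the form the additive types `IV` / `IV*` / `I₀*` / `Iₙ*` need (`E.vals` = `[1,3]`, `[1,2,4]`, `[2,4]`),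
where no single value is certified. [cite: SilvermanAEC2009, VII.2 Prop. 2.1 and IV.3 Prop. 3.2(b)]
[cite: SilvermanATAEC1994, IV.9.4] -/
theorem natCard_ker_nsmul_adicCompletion_eq_one_of_intModel_of_tamLocal_forall
    (hI : integralModelInt W = W₀) (ℓ p : ℕ) [Fact ℓ.Prime] [Fact p.Prime] (hℓp : ℓ ≠ p)
    {v : HeightOneSpectrum (𝓞 ℚ)} (hv : (primesEquiv v : ℕ) = ℓ)
    {E : TamLocal} (hEp : E.p = ℓ) (hcheck : E.check W₀ = true)
    {N : ℕ} (hN : reductionPointCount W ℓ = N) (h : ∀ c ∈ E.vals, ¬ p ∣ c * N) :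
    Nat.card (nsmulAddMonoidHom p : (W.baseChange (v.adicCompletion ℚ)).toAffine.Point →+
      (W.baseChange (v.adicCompletion ℚ)).toAffine.Point).ker = 1 :=
  natCard_ker_nsmul_adicCompletion_eq_one_of_eq_of_eq W ℓ p hℓp hv rfl hN
    (h _ (localTamagawaNumber_mem_of_intModel_of_tamLocal hI (hv.trans hEp.symm) hcheck))

/-- **`hloc` at an ADDITIVE place `v ∤ p` from a value-SET Tate certificate**: `ℓ ∣ Δ(W₀)`,
`ℓ ∣ c₄(W₀)` (`N_ℓ = ℓ`), ONE `TamLocal` certificate at `ℓ` and `p ∤ c · ℓ` for every certified value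
`c` ⟹ `#ker([p] : E(ℚ_v)) = 1`. [cite: SilvermanAEC2009, VII.2 Prop. 2.1, IV.3 Prop. 3.2(b), VII.5 Prop. 5.1(c)]
[cite: SilvermanATAEC1994, IV.9.4] -/
theorem natCard_ker_nsmul_adicCompletion_eq_one_of_intModel_of_additive_tamLocal_forall
    (hI : integralModelInt W = W₀) (ℓ p : ℕ) [Fact ℓ.Prime] [Fact p.Prime] (hℓp : ℓ ≠ p)
    {v : HeightOneSpectrum (𝓞 ℚ)} (hv : (primesEquiv v : ℕ) = ℓ)
    (hΔ : (ℓ : ℤ) ∣ W₀.Δ) (hc₄ : (ℓ : ℤ) ∣ W₀.c₄)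
    {E : TamLocal} (hEp : E.p = ℓ) (hcheck : E.check W₀ = true) (h : ∀ c ∈ E.vals, ¬ p ∣ c * ℓ) :
    Nat.card (nsmulAddMonoidHom p : (W.baseChange (v.adicCompletion ℚ)).toAffine.Point →+
      (W.baseChange (v.adicCompletion ℚ)).toAffine.Point).ker = 1 :=
  natCard_ker_nsmul_adicCompletion_eq_one_of_intModel_of_tamLocal_forall hI ℓ p hℓp hv hEp hcheck
    (Additive.LocalLog.reductionPointCount_of_addv W ℓ (Additive.addv_of_intModel hI ℓ hΔ hc₄)) h

/-- **`hloc` at a SPLIT multiplicative place `v ∤ p`, value-set form** (root witness `t`; `N = ℓ − 1`).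
[cite: SilvermanAEC2009, VII.2 Prop. 2.1, IV.3 Prop. 3.2(b), VII.5 Prop. 5.1(b)] -/
theorem natCard_ker_nsmul_adicCompletion_eq_one_of_intModel_of_nodal_root_forall
    (hI : integralModelInt W = W₀) (ℓ p : ℕ) [Fact ℓ.Prime] [Fact p.Prime] (hℓp : ℓ ≠ p)
    {v : HeightOneSpectrum (𝓞 ℚ)} (hv : (primesEquiv v : ℕ) = ℓ)
    (hΔ : (ℓ : ℤ) ∣ W₀.Δ) (hc₄ : ¬ (ℓ : ℤ) ∣ W₀.c₄) {t : ℤ}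
    (ht : (ℓ : ℤ) ∣ RootNumber.nodalValue W₀ t)
    {E : TamLocal} (hEp : E.p = ℓ) (hcheck : E.check W₀ = true) (h : ∀ c ∈ E.vals, ¬ p ∣ c * (ℓ - 1)) :
    Nat.card (nsmulAddMonoidHom p : (W.baseChange (v.adicCompletion ℚ)).toAffine.Point →+
      (W.baseChange (v.adicCompletion ℚ)).toAffine.Point).ker = 1 :=
  natCard_ker_nsmul_adicCompletion_eq_one_of_intModel_of_tamLocal_forall hI ℓ p hℓp hv hEp hcheck
    (N := ℓ - 1) (by have := reductionPointCount_eq_of_intModel_of_nodal_root hI ℓ hΔ hc₄ ht; omega) h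

/-- **`hloc` at a NON-SPLIT multiplicative place `v ∤ p`, value-set form** (Euler witness; `N = ℓ + 1`).
[cite: SilvermanAEC2009, VII.2 Prop. 2.1, IV.3 Prop. 3.2(b), VII.5 Prop. 5.1(b)] -/
theorem natCard_ker_nsmul_adicCompletion_eq_one_of_intModel_of_nodal_euler_forall
    (hI : integralModelInt W = W₀) (ℓ p : ℕ) [Fact ℓ.Prime] [Fact p.Prime] (hℓp : ℓ ≠ p)
    {v : HeightOneSpectrum (𝓞 ℚ)} (hv : (primesEquiv v : ℕ) = ℓ)
    (hΔ : (ℓ : ℤ) ∣ W₀.Δ) (hc₄ : ¬ (ℓ : ℤ) ∣ W₀.c₄) (h2 : ℓ ≠ 2)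
    (heuler : ((RootNumber.nodalDisc W₀ : ℤ) : ZMod ℓ) ^ (ℓ / 2) = -1)
    {E : TamLocal} (hEp : E.p = ℓ) (hcheck : E.check W₀ = true) (h : ∀ c ∈ E.vals, ¬ p ∣ c * (ℓ + 1)) :
    Nat.card (nsmulAddMonoidHom p : (W.baseChange (v.adicCompletion ℚ)).toAffine.Point →+
      (W.baseChange (v.adicCompletion ℚ)).toAffine.Point).ker = 1 :=
  natCard_ker_nsmul_adicCompletion_eq_one_of_intModel_of_tamLocal_forall hI ℓ p hℓp hv hEp hcheck
    (reductionPointCount_eq_of_intModel_of_nodal_euler hI ℓ hΔ hc₄ h2 heuler) h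

end IntModelVals

end Summit.BirchSwinnertonDyer.Rank1Residual.GaloisImage.LocalTorsionAway

end
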